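import Mathlib
import Summits.Ventures.PercRepro.TriangleCapThreeTrianglesG

/-!
# PercRepro — THREE BELOW THE DIAGONAL, THREE TRIANGLES AT `(9, 15)`, PART B: THE PATH (p3, gen 38; part 117)
The path count of TriangleCapThreeBelowThreeTrianglesD at the cell `(9, 15)` with the per-vertex bound kept exact:
`4W + 2s² + 2sd ≤ 18s + 9d` for every vertex off `S` (`W ≤ 3s + [z ∼ t ∨ z ∼ t′]`, `s ≤ 2` on the hanging
vertices, `s ≥ 1` there), and the density `2m = Q + 2Σs + Σd`: `Σ deficit ≥ 2Q + 112 − 4Q − 2(30 − Q) = 52 ≥ 48`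
(**`six_mul_card_le_sum_deficit_add_six_of_path_nine`**).  Numbers (mining/p3/g38/path9.c): the minimum of
`Σ deficit` over the path graphs at `(9, 15)` is `56` (two outside vertices of `s = 2`, non-adjacent).  Axioms: standard.
-/

namespace PercRepro

namespace TriangleCap

namespace C047

open Finset

variable {V : Type*} [Fintype V] [DecidableEq V]

/-- **THE FAR COUNT FOR THREE TRIANGLES FORMING A PATH AT `(9, 15)`:** `54 ≤ Σ_p deficit(p) + 6`
(the per-vertex bound `4W + 2s² + 2sd ≤ 18s + 9d` and the density). -/
theorem six_mul_card_le_sum_deficit_add_six_of_path_nine (D : SimpleGraph V) [DecidableRel D.Adj]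
    (T₁ T₂ T₃ : Finset V) (h₁ : T₁.card = 3) (h₂ : T₂.card = 3) (h₃ : T₃.card = 3) {t t' : V}
    (hint : T₁ ∩ T₂ = {t}) (hint' : T₂ ∩ T₃ = {t'}) (h13 : Disjoint T₁ T₃)
    (hcl₁ : ∀ x ∈ T₁, ∀ y ∈ T₁, x ≠ y → D.Adj x y) (hcl₂ : ∀ x ∈ T₂, ∀ y ∈ T₂, x ≠ y → D.Adj x y)
    (hcl₃ : ∀ x ∈ T₃, ∀ y ∈ T₃, x ≠ y → D.Adj x y)
    (hone₁ : ∀ z, z ∉ T₁ → degIn D T₁ z ≤ 1) (hone₂ : ∀ z, z ∉ T₂ → degIn D T₂ z ≤ 1)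
    (hone₃ : ∀ z, z ∉ T₃ → degIn D T₃ z ≤ 1) (hk : Fintype.card V = 9) (hm : D.edgeFinset.card = 15) :
    6 * Fintype.card V ≤ ∑ p ∈ adjPairsAll D, deficit D p + 6 := by
  have hi12 : (T₁ ∩ T₂).card ≤ 1 := by rw [hint, card_singleton]
  have hi13 : (T₁ ∩ T₃).card ≤ 1 := by rw [disjoint_iff_inter_eq_empty.mp h13, card_empty]; exact Nat.zero_le _
  have hi23 : (T₂ ∩ T₃).card ≤ 1 := by rw [hint', card_singleton]
  have hcount := three_triangles_far_count D T₁ T₂ T₃ h₁ h₂ h₃ hi12 hi13 hi23 hcl₁ hcl₂ hcl₃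
  have ht1 : t ∈ T₁ := (mem_inter.mp (by rw [hint]; exact mem_singleton_self t)).1
  have ht2 : t ∈ T₂ := (mem_inter.mp (by rw [hint]; exact mem_singleton_self t)).2
  have ht'2 : t' ∈ T₂ := (mem_inter.mp (by rw [hint']; exact mem_singleton_self t')).1
  have ht'3 : t' ∈ T₃ := (mem_inter.mp (by rw [hint']; exact mem_singleton_self t')).2
  have htt' : t ≠ t' := fun h => disjoint_left.mp h13 ht1 (h ▸ ht'3)
  have ht3 : t ∉ T₃ := fun h => disjoint_left.mp h13 ht1 h
  have ht'1 : t' ∉ T₁ := fun h => disjoint_left.mp h13 h ht'3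
  set S := T₁ ∪ T₂ ∪ T₃ with hS
  have h12card : (T₁ ∪ T₂).card = 5 := by
    have := card_union_add_card_inter T₁ T₂
    rw [hint, card_singleton, h₁, h₂] at this
    omega
  have hScard : S.card = 7 := by
    have := card_union_add_card_inter (T₁ ∪ T₂) T₃
    have hi : (T₁ ∪ T₂) ∩ T₃ = {t'} := by
      rw [union_inter_distrib_right, disjoint_iff_inter_eq_empty.mp h13, hint', empty_union]
    rw [hi, card_singleton, h12card, h₃] at this
    rw [hS]; omega
  have hRcard : Sᶜ.card + 7 = Fintype.card V := by rw [card_compl, hScard]; omega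
  have htS : t ∈ S := mem_union_left _ (mem_union_left _ ht1)
  have ht'S : t' ∈ S := mem_union_right _ ht'3
  have hmem : ∀ x ∈ S, x ∈ T₁ ∨ x ∈ T₂ ∨ x ∈ T₃ := by
    intro x hx
    rw [hS, mem_union, mem_union] at hx
    tauto
  have hin12 : ∀ x, x ∈ T₁ → x ∈ T₂ → x = t := fun x h1 h2 => by
    have : x ∈ T₁ ∩ T₂ := mem_inter.mpr ⟨h1, h2⟩
    rwa [hint, mem_singleton] at this
  have hin23 : ∀ x, x ∈ T₂ → x ∈ T₃ → x = t' := fun x h2 h3 => by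
    have : x ∈ T₂ ∩ T₃ := mem_inter.mpr ⟨h2, h3⟩
    rwa [hint', mem_singleton] at this
  -- the degrees into `S`
  have hcr_t : degIn D S t ≤ 4 := by
    have hsub : S.filter (fun y => D.Adj t y) ⊆ (T₁ ∪ T₂).erase t := by
      intro y hy
      rw [mem_filter] at hy
      rw [mem_erase, mem_union]
      refine ⟨hy.2.ne.symm, ?_⟩
      rcases hmem y hy.1 with h | h | h
      · exact Or.inl h
      · exact Or.inr h
      · have := eq_of_degIn_le_one D (hone₃ t ht3) ht'3 (hcl₂ t ht2 t' ht'2 htt') h hy.2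
        rw [this]; exact Or.inr ht'2
    have := card_le_card hsub
    rw [card_erase_of_mem (mem_union_left T₂ ht1), h12card] at this
    exact this
  have hcr_t' : degIn D S t' ≤ 4 := by
    have hsub : S.filter (fun y => D.Adj t' y) ⊆ (T₂ ∪ T₃).erase t' := by
      intro y hy
      rw [mem_filter] at hy
      rw [mem_erase, mem_union]
      refine ⟨hy.2.ne.symm, ?_⟩
      rcases hmem y hy.1 with h | h | h
      · have := eq_of_degIn_le_one D (hone₁ t' ht'1) ht1 (hcl₂ t' ht'2 t ht2 (Ne.symm htt')) h hy.2
        rw [this]; exact Or.inl ht2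
      · exact Or.inl h
      · exact Or.inr h
    have h23card : (T₂ ∪ T₃).card = 5 := by
      have := card_union_add_card_inter T₂ T₃
      rw [hint', card_singleton, h₂, h₃] at this
      omega
    have := card_le_card hsub
    rw [card_erase_of_mem (mem_union_left T₃ ht'2), h23card] at this
    exact this
  -- a vertex of `T₁ ∖ t` or `T₃ ∖ t'`: at most `3`; the middle vertex of `T₂`: at most `2`
  have hcr_one : ∀ x ∈ T₁, x ≠ t → degIn D S x ≤ 3 := by
    intro x hx hxt
    have hx2 : x ∉ T₂ := fun h => hxt (hin12 x hx h)
    have hx3 : x ∉ T₃ := fun h => disjoint_left.mp h13 hx h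
    have hsub : S.filter (fun y => D.Adj x y) ⊆ T₁.filter (fun y => D.Adj x y) ∪ T₃.filter (fun y => D.Adj x y) := by
      intro y hy
      rw [mem_filter] at hy
      rw [mem_union, mem_filter, mem_filter]
      rcases hmem y hy.1 with h | h | h
      · exact Or.inl ⟨h, hy.2⟩
      · have := eq_of_degIn_le_one D (hone₂ x hx2) ht2 (hcl₁ x hx t ht1 hxt) h hy.2
        rw [this]; exact Or.inl ⟨ht1, hcl₁ x hx t ht1 hxt⟩
      · exact Or.inr ⟨h, hy.2⟩
    have := card_le_card hsub
    have hu := card_union_le (T₁.filter (fun y => D.Adj x y)) (T₃.filter (fun y => D.Adj x y))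
    have h2 := degIn_le_two_of_mem D h₁ hx
    have h3 := hone₃ x hx3
    unfold degIn at h2 h3 ⊢
    omega
  have hcr_three : ∀ x ∈ T₃, x ≠ t' → degIn D S x ≤ 3 := by
    intro x hx hxt
    have hx2 : x ∉ T₂ := fun h => hxt (hin23 x h hx)
    have hx1 : x ∉ T₁ := fun h => disjoint_left.mp h13 h hx
    have hsub : S.filter (fun y => D.Adj x y) ⊆ T₁.filter (fun y => D.Adj x y) ∪ T₃.filter (fun y => D.Adj x y) := by
      intro y hy
      rw [mem_filter] at hy
      rw [mem_union, mem_filter, mem_filter]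
      rcases hmem y hy.1 with h | h | h
      · exact Or.inl ⟨h, hy.2⟩
      · have := eq_of_degIn_le_one D (hone₂ x hx2) ht'2 (hcl₃ x hx t' ht'3 hxt) h hy.2
        rw [this]; exact Or.inr ⟨ht'3, hcl₃ x hx t' ht'3 hxt⟩
      · exact Or.inr ⟨h, hy.2⟩
    have := card_le_card hsub
    have hu := card_union_le (T₁.filter (fun y => D.Adj x y)) (T₃.filter (fun y => D.Adj x y))
    have h2 := degIn_le_two_of_mem D h₃ hx
    have h1 := hone₁ x hx1
    unfold degIn at h2 h1 ⊢
    omega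
  have hcr_mid : ∀ x ∈ T₂, x ≠ t → x ≠ t' → degIn D S x ≤ 2 := by
    intro x hx hxt hxt'
    have hx1 : x ∉ T₁ := fun h => hxt (hin12 x h hx)
    have hx3 : x ∉ T₃ := fun h => hxt' (hin23 x hx h)
    have hsub : S.filter (fun y => D.Adj x y) ⊆ T₂.filter (fun y => D.Adj x y) := by
      intro y hy
      rw [mem_filter] at hy
      rw [mem_filter]
      refine ⟨?_, hy.2⟩
      rcases hmem y hy.1 with h | h | h
      · have := eq_of_degIn_le_one D (hone₁ x hx1) ht1 (hcl₂ x hx t ht2 hxt) h hy.2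
        rw [this]; exact ht2
      · exact h
      · have := eq_of_degIn_le_one D (hone₃ x hx3) ht'3 (hcl₂ x hx t' ht'2 hxt') h hy.2
        rw [this]; exact ht'2
    have := card_le_card hsub
    have h2 := degIn_le_two_of_mem D h₂ hx
    unfold degIn at h2 ⊢
    omega
  have hcr_le : ∀ x ∈ S, degIn D S x ≤ 3 + (if x = t then 1 else 0) + (if x = t' then 1 else 0) := by
    intro x hx
    by_cases hxt : x = t
    · subst x; simp only [if_true, htt', if_false]; omega
    by_cases hxt' : x = t'
    · subst x; simp only [if_true, Ne.symm htt', if_false]; omega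
    simp only [hxt, hxt', if_false, add_zero]
    rcases hmem x hx with h | h | h
    · exact hcr_one x h hxt
    · have := hcr_mid x h hxt hxt'; omega
    · exact hcr_three x h hxt'
  have hcr_ge : ∀ x ∈ S, 2 ≤ degIn D S x := by
    intro x hx
    rcases hmem x hx with h | h | h
    · have h1 : degIn D T₁ x ≤ degIn D S x := degIn_mono D (subset_union_left.trans subset_union_left) x
      rw [degIn_self_of_clique D h₁ hcl₁ h] at h1; exact h1
    · have h1 : degIn D T₂ x ≤ degIn D S x := degIn_mono D (subset_union_right.trans subset_union_left) x
      rw [degIn_self_of_clique D h₂ hcl₂ h] at h1; exact h1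
    · have h1 : degIn D T₃ x ≤ degIn D S x := degIn_mono D subset_union_right x
      rw [degIn_self_of_clique D h₃ hcl₃ h] at h1; exact h1
  have hcr_t_ge : 4 ≤ degIn D S t := by
    have hsub : (T₁.erase t ∪ T₂.erase t) ⊆ S.filter (fun y => D.Adj t y) := by
      intro y hy
      rw [mem_union, mem_erase, mem_erase] at hy
      rw [mem_filter]
      rcases hy with ⟨hyt, hy⟩ | ⟨hyt, hy⟩
      · exact ⟨mem_union_left _ (mem_union_left _ hy), hcl₁ t ht1 y hy (Ne.symm hyt)⟩
      · exact ⟨mem_union_left _ (mem_union_right _ hy), hcl₂ t ht2 y hy (Ne.symm hyt)⟩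
    have hdisj : Disjoint (T₁.erase t) (T₂.erase t) := by
      rw [disjoint_left]
      intro y hy1 hy2
      rw [mem_erase] at hy1 hy2
      exact hy1.1 (hin12 y hy1.2 hy2.2)
    have := card_le_card hsub
    rw [card_union_of_disjoint hdisj, card_erase_of_mem ht1, card_erase_of_mem ht2, h₁, h₂] at this
    exact this
  have hcr_t'_ge : 4 ≤ degIn D S t' := by
    have hsub : (T₂.erase t' ∪ T₃.erase t') ⊆ S.filter (fun y => D.Adj t' y) := by
      intro y hy
      rw [mem_union, mem_erase, mem_erase] at hy
      rw [mem_filter]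
      rcases hy with ⟨hyt, hy⟩ | ⟨hyt, hy⟩
      · exact ⟨mem_union_left _ (mem_union_right _ hy), hcl₂ t' ht'2 y hy (Ne.symm hyt)⟩
      · exact ⟨mem_union_right _ hy, hcl₃ t' ht'3 y hy (Ne.symm hyt)⟩
    have hdisj : Disjoint (T₂.erase t') (T₃.erase t') := by
      rw [disjoint_left]
      intro y hy1 hy2
      rw [mem_erase] at hy1 hy2
      exact hy1.1 (hin23 y hy1.2 hy2.2)
    have := card_le_card hsub
    rw [card_union_of_disjoint hdisj, card_erase_of_mem ht'2, card_erase_of_mem ht'3, h₂, h₃] at this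
    exact this
  -- `18 ≤ Q ≤ 22` and the triangle sums `≤ Q + 8`
  have hQeq : adjPairs D S = ∑ x ∈ S, degIn D S x := adjPairs_eq_sum_degIn D S
  have hQle : adjPairs D S ≤ 22 := by
    rw [hQeq]
    have hm1 : ((T₂.erase t).erase t').card = 1 := by
      rw [card_erase_of_mem (mem_erase.mpr ⟨Ne.symm htt', ht'2⟩), card_erase_of_mem ht2, h₂]
    obtain ⟨m, hm⟩ := card_eq_one.mp hm1
    have hmT : m ∈ T₂ := by
      have : m ∈ (T₂.erase t).erase t' := by rw [hm]; exact mem_singleton_self m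
      exact mem_of_mem_erase (mem_of_mem_erase this)
    have hmt : m ≠ t := by
      have : m ∈ (T₂.erase t).erase t' := by rw [hm]; exact mem_singleton_self m
      exact ne_of_mem_erase (mem_of_mem_erase this)
    have hmt' : m ≠ t' := by
      have : m ∈ (T₂.erase t).erase t' := by rw [hm]; exact mem_singleton_self m
      exact ne_of_mem_erase this
    have hmS : m ∈ S := mem_union_left _ (mem_union_right _ hmT)
    have ht'e : t' ∈ S.erase t := mem_erase.mpr ⟨Ne.symm htt', ht'S⟩
    have hme : m ∈ (S.erase t).erase t' := mem_erase.mpr ⟨hmt', mem_erase.mpr ⟨hmt, hmS⟩⟩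
    have e1 := (add_sum_erase S (degIn D S) htS).symm
    have e2 := (add_sum_erase (S.erase t) (degIn D S) ht'e).symm
    have e3 := (add_sum_erase ((S.erase t).erase t') (degIn D S) hme).symm
    have hrest : ∑ x ∈ ((S.erase t).erase t').erase m, degIn D S x ≤
        ∑ _x ∈ ((S.erase t).erase t').erase m, 3 := by
      apply sum_le_sum
      intro x hx
      have hxm := ne_of_mem_erase hx
      have hxt' := ne_of_mem_erase (mem_of_mem_erase hx)
      have hxt := ne_of_mem_erase (mem_of_mem_erase (mem_of_mem_erase hx))
      have hxS := mem_of_mem_erase (mem_of_mem_erase (mem_of_mem_erase hx))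
      rcases hmem x hxS with h | h | h
      · exact hcr_one x h hxt
      · exfalso
        have : x ∈ (T₂.erase t).erase t' := mem_erase.mpr ⟨hxt', mem_erase.mpr ⟨hxt, h⟩⟩
        rw [hm, mem_singleton] at this
        exact hxm this
      · exact hcr_three x h hxt'
    rw [sum_const, card_erase_of_mem hme, card_erase_of_mem ht'e, card_erase_of_mem htS, hScard,
      smul_eq_mul] at hrest
    have := hcr_mid m hmT hmt hmt'
    omega
  have hQge : 18 ≤ adjPairs D S := by
    rw [hQeq]
    have e1 := (add_sum_erase S (degIn D S) htS).symm
    have ht'e : t' ∈ S.erase t := mem_erase.mpr ⟨Ne.symm htt', ht'S⟩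
    have e2 := (add_sum_erase (S.erase t) (degIn D S) ht'e).symm
    have hge : ∑ _x ∈ (S.erase t).erase t', 2 ≤ ∑ x ∈ (S.erase t).erase t', degIn D S x :=
      sum_le_sum (fun x hx => hcr_ge x (mem_of_mem_erase (mem_of_mem_erase hx)))
    rw [sum_const, card_erase_of_mem ht'e, card_erase_of_mem htS, hScard, smul_eq_mul] at hge
    omega
  have hA : ∑ x ∈ T₁, degIn D S x + ∑ x ∈ T₂, degIn D S x + ∑ x ∈ T₃, degIn D S x ≤ adjPairs D S + 8 := by
    have e2 := sum_union_inter (s₁ := T₁) (s₂ := T₂) (f := degIn D S)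
    rw [hint, sum_singleton] at e2
    have e3 := sum_union_inter (s₁ := T₁ ∪ T₂) (s₂ := T₃) (f := degIn D S)
    have hi : (T₁ ∪ T₂) ∩ T₃ = {t'} := by
      rw [union_inter_distrib_right, disjoint_iff_inter_eq_empty.mp h13, hint', empty_union]
    rw [hi, sum_singleton, ← hS, ← hQeq] at e3
    omega
  have hout : ∀ z ∈ Sᶜ, degIn D S z ≤ 3 := by
    intro z hz
    rw [mem_compl, hS, mem_union, mem_union, not_or, not_or] at hz
    have h := degIn_union_le D (T₁ ∪ T₂) T₃ z
    have h2 := degIn_union_le D T₁ T₂ z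
    have := hone₁ z hz.1.1
    have := hone₂ z hz.1.2
    have := hone₃ z hz.2
    rw [hS]
    omega
  -- a vertex hanging on `t` (or `t'`) has at most two neighbours in `S`
  have hhang : ∀ z ∈ Sᶜ, (D.Adj z t ∨ D.Adj z t') → degIn D S z ≤ 2 := by
    intro z hz hzt
    rw [mem_compl, hS, mem_union, mem_union, not_or, not_or] at hz
    rcases hzt with hzt | hzt
    · have hsub : S.filter (fun y => D.Adj z y) ⊆ {t} ∪ T₃.filter (fun y => D.Adj z y) := by
        intro y hy
        rw [mem_filter] at hy
        rw [mem_union, mem_singleton, mem_filter]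
        rcases hmem y hy.1 with h | h | h
        · exact Or.inl (eq_of_degIn_le_one D (hone₁ z hz.1.1) ht1 hzt h hy.2)
        · exact Or.inl (eq_of_degIn_le_one D (hone₂ z hz.1.2) ht2 hzt h hy.2)
        · exact Or.inr ⟨h, hy.2⟩
      have := card_le_card hsub
      have hu := card_union_le ({t} : Finset V) (T₃.filter (fun y => D.Adj z y))
      have h3 := hone₃ z hz.2
      unfold degIn at h3 ⊢
      rw [card_singleton] at hu
      omega
    · have hsub : S.filter (fun y => D.Adj z y) ⊆ {t'} ∪ T₁.filter (fun y => D.Adj z y) := by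
        intro y hy
        rw [mem_filter] at hy
        rw [mem_union, mem_singleton, mem_filter]
        rcases hmem y hy.1 with h | h | h
        · exact Or.inr ⟨h, hy.2⟩
        · exact Or.inl (eq_of_degIn_le_one D (hone₂ z hz.1.2) ht'2 hzt h hy.2)
        · exact Or.inl (eq_of_degIn_le_one D (hone₃ z hz.2) ht'3 hzt h hy.2)
      have := card_le_card hsub
      have hu := card_union_le ({t'} : Finset V) (T₁.filter (fun y => D.Adj z y))
      have h1 := hone₁ z hz.1.1
      unfold degIn at h1 ⊢
      rw [card_singleton] at hu
      omega
  -- `W(z) ≤ 3 s + [z ~ t ∨ z ~ t']`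
  have hW : ∀ z ∈ Sᶜ, ∑ x ∈ S.filter (fun x => D.Adj z x), degIn D S x ≤
      3 * degIn D S z + (if D.Adj z t ∨ D.Adj z t' then 1 else 0) := by
    intro z hz
    have hzz : ∀ x ∈ S.filter (fun x => D.Adj z x), degIn D S x ≤ 3 + (if x = t ∨ x = t' then 1 else 0) := by
      intro x hx
      rw [mem_filter] at hx
      have h := hcr_le x hx.1
      by_cases h1 : x = t
      · simp only [h1, true_or, if_true]; subst x; simp only [if_true, htt', if_false] at h; omega
      by_cases h2 : x = t'
      · simp only [h2, or_true, if_true]; subst x; simp only [if_true, Ne.symm htt', if_false] at h; omega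
      simp only [h1, h2, or_self, if_false, add_zero] at h ⊢
      exact h
    calc ∑ x ∈ S.filter (fun x => D.Adj z x), degIn D S x ≤
        ∑ x ∈ S.filter (fun x => D.Adj z x), (3 + (if x = t ∨ x = t' then 1 else 0)) := sum_le_sum hzz
      _ ≤ 3 * degIn D S z + (if D.Adj z t ∨ D.Adj z t' then 1 else 0) := by
          rw [sum_add_distrib, sum_const, smul_eq_mul]
          -- at most one of `t, t'` is a neighbour of `z`
          have hsum : (∑ x ∈ S.filter (fun x => D.Adj z x), if x = t ∨ x = t' then 1 else 0) ≤
              if D.Adj z t ∨ D.Adj z t' then 1 else 0 := by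
            rw [← sum_filter, filter_filter, ← card_eq_sum_ones]
            by_cases hzt : D.Adj z t ∨ D.Adj z t'
            · rw [if_pos hzt]
              apply card_le_one.mpr
              intro p hp q hq
              rw [mem_filter] at hp hq
              -- `z` is not adjacent to both `t` and `t'` (they are adjacent)
              have hnot : ¬ (D.Adj z t ∧ D.Adj z t') := by
                rintro ⟨h1, h2⟩
                rw [mem_compl, hS, mem_union, mem_union, not_or, not_or] at hz
                have := eq_of_degIn_le_one D (hone₂ z hz.1.2) ht2 h1 ht'2 h2
                exact htt' this.symm
              rcases hp.2.2 with hp' | hp' <;> rcases hq.2.2 with hq' | hq' <;> subst hp' <;> subst hq'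
              · rfl
              · exact absurd ⟨hp.2.1, hq.2.1⟩ hnot
              · exact absurd ⟨hq.2.1, hp.2.1⟩ hnot
              · rfl
            · rw [if_neg hzt, Nat.le_zero, card_eq_zero, filter_eq_empty_iff]
              intro x _ h
              rcases h with ⟨hzx, rfl | rfl⟩
              · exact hzt (Or.inl hzx)
              · exact hzt (Or.inr hzx)
          unfold degIn
          omega
  -- the pointwise bound off `S`: `4 W + 2 s² + 2 s d ≤ 14 s + 7 d + 12`
  have hpt : ∀ z ∈ Sᶜ, 4 * ∑ x ∈ S.filter (fun x => D.Adj z x), degIn D S x +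
      2 * (degIn D S z * degIn D S z) + 2 * (degIn D S z * degIn D Sᶜ z) ≤
      18 * degIn D S z + 9 * degIn D Sᶜ z := by
    intro z hz
    have hWz := hW z hz
    have hs := hout z hz
    by_cases hzt : D.Adj z t ∨ D.Adj z t'
    · have := hhang z hz hzt
      have hs1 : 1 ≤ degIn D S z := by
        unfold degIn
        apply card_pos.mpr
        rcases hzt with h | h
        · exact ⟨t, mem_filter.mpr ⟨htS, h⟩⟩
        · exact ⟨t', mem_filter.mpr ⟨ht'S, h⟩⟩
      rw [if_pos hzt] at hWz
      set s := degIn D S z with hsdef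
      clear_value s
      interval_cases s <;> omega
    · rw [if_neg hzt, add_zero] at hWz
      set s := degIn D S z with hsdef
      clear_value s
      interval_cases s <;> omega
  have hptsum := sum_le_sum hpt
  rw [sum_add_distrib, sum_add_distrib, sum_add_distrib, ← mul_sum, ← mul_sum, ← mul_sum,
    ← mul_sum, ← mul_sum] at hptsum
  rw [hScard] at hcount
  have hdens := two_mul_card_edges_eq_adjPairs_add D S
  have hR2 : Sᶜ.card = 2 := by omega
  rw [hR2] at hcount
  rw [hm] at hdens
  rw [hk]
  set Q := adjPairs D S with hQdef
  set Def := ∑ p ∈ adjPairsAll D, deficit D p with hDef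
  clear_value Q Def
  linarith


end C047

end TriangleCap

end PercRepro
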